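import Literature.AnabelianGeometry.EtaleTheta.Discharge.Sec1CuspInertiaEllDivisible
import Literature.AnabelianGeometry.EtaleTheta.ThetaCyclotomes
import HarnessLib

/-!
# [EtTh] §2's hypothesis «`Ker(Π^tp_Y ↠ (Π^tp_Y)^ell) ⊆ Π^tp_{Y_N}`» (`Sec2Hyps`) is a THEOREM at every joint origin;
# `Sec2Hyps` reduces to the printed standing assumption «`K = K̈`» (proof-only)

Mochizuki, *The étale theta function and its Frobenioid-theoretic manifestations*, Publ. RIMS **45** (2009) [EtTh], §1 p. 13
(«an open immersion `G_{K_N} ↪ (Π^tp_Y)^ell/N·(Δ^tp_Y)^ell` the image of which … determines a Galois covering `Y_N → Y`»),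
p. 16 («`Δ^tp_Y/Δ^tp_{Y_N} ≅ ℤ/Nℤ(1)`»), Def. 2.5 p. 39 / Def. 1.7 (I) p. 27 («`K = K̈`») [cite: MochizukiEtTh2009, Def 2.5 p.39].
abc-iut cell, layer L2, seat abc-iut-w5-d062 (gen 5).  PROOF-ONLY (no definition, no new named fact).

abc-iut-L2-t8's `ThetaSetting.Sec2Hyps` (`ThetaCyclotomes.lean`) bundles two printed sentences that §2 invokes and the root
file does not record: (1) «`K = K̈`» and (2) `Ker(Π^tp_X ↠ (Π^tp_X)^ell) ∩ Π^tp_Y ≤ Π^tp_{Y_N}` for every `N`.  Clause (2) is NOT a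
consequence of the root axioms (abc-iut-L2-d1's `not_forall_ker_toEll_inf_GtpY_le_GtpYN_of_hYcl`, a twisted model), but it IS a
theorem at every setting carrying the origin predicates the K3 end-knits already consume:

* **`ThetaSetting.ker_toEll_inf_GtpY_le_GtpYN_of_tate`** / **`…_of_origins`** — from clause (a) of the Tate-module datum at level
  `N` (`IsTateOrigin`), R2 at level `N` and a cusp inside `Π^tp_Y` (`IsThm16Origin`): `Δ^tp_{Y_N}` IS the `N`-th-power locus of
  `(Δ^tp_Y)^ell` (abc-iut-w5-d051's `dtpYN_eq_dtpY_inf_comap_ellPowersY`), and the kernel of `↠ell` lies in `Δ^tp_X`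
  (`ker_toEll_le_deltaTemp`) and dies in `(Π^tp_X)^ell`;
* **`ThetaSetting.sec2Hyps_of_Kdd_eq_of_origins`** — hence `Sec2Hyps` ⟸ {«`K = K̈`», `IsThm16Origin`, `IsTateOrigin`}: the binder
  `hSβ : Dβ.Sec2Hyps` of the K3 end-knits (`Thm16Sub.thm16iii_of_origins…`) reduces, at a joint origin, to print's standing
  assumption «`K = K̈`» alone.
HONEST FRAMING: [EtTh] is refereed; nothing asserted beyond the tree's proofs; the origin predicates are hypotheses inhabited only
at semi-synthetic models; nothing here bears on [IUTchIII] Cor. 3.12; typed ≠ proved.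
-/

noncomputable section

namespace Literature.AnabelianGeometry.EtaleTheta

open Literature.AnabelianGeometry.SemiGraphs Thm16Sub

namespace ThetaSetting

variable {p : ℕ} [Fact p.Prime] {D : ThetaSetting p}

/-- **«`Ker(↠ell) ∩ Π^tp_Y ≤ Π^tp_{Y_N}`» from the Tate-module datum at level `N`**: given a generator `y₁` of `(Δ^tp_Y)^ell` modulo
`N` (clause (a)), R2 at level `N` and a cusp inside `Π^tp_Y`, every element of `Π^tp_Y` dying in `(Π^tp_X)^ell` lies in `Π^tp_{Y_N}`
(it lies in `Δ^tp_Y` by `ker_toEll_le_deltaTemp`, and `1 ∈ N·(Δ^tp_Y)^ell`). [cite: MochizukiEtTh2009, §1 p.13] -/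
theorem ker_toEll_inf_GtpY_le_GtpYN_of_tate (N : ℕ+) {y₁ : D.PiTemp} (hy₁ : y₁ ∈ D.DtpY)
    (ha : ∀ y ∈ D.DtpY, ∃ k : ℕ, toEll D y * (toEll D y₁ ^ k)⁻¹ ∈ ellPowersY D N)
    (hR2 : GtpYNFromCusp D N)
    (hcusp : ∃ Dc : Subgroup D.PiTemp, D.IsCuspidalDecompositionGroup Dc ∧ Dc ≤ D.GtpY) :
    (D.thetaToEll.comp D.toTheta).ker ⊓ D.GtpY ≤ D.GtpYN N := by
  intro x hx
  obtain ⟨hker, hY⟩ := Subgroup.mem_inf.mp hx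
  have hΔ : x ∈ D.DeltaTemp := D.ker_toEll_le_deltaTemp hker
  have hx1 : toEll D x = 1 := (MonoidHom.mem_ker).mp hker
  have hmem : x ∈ D.DtpY ⊓ (ellPowersY D N).comap (toEll D) := by
    refine Subgroup.mem_inf.mpr ⟨Subgroup.mem_inf.mpr ⟨hY, hΔ⟩, ?_⟩
    rw [Subgroup.mem_comap, hx1]
    exact Subgroup.one_mem _
  rw [← D.dtpYN_eq_dtpY_inf_comap_ellPowersY N hy₁ ha hR2 hcusp] at hmem
  exact (Subgroup.mem_inf.mp hmem).1

/-- **«`Ker(↠ell) ∩ Π^tp_Y ≤ Π^tp_{Y_N}`» for EVERY `N` at a joint origin** (`IsThm16Origin`: R2 ∀N and the cusp of `X^log` in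
`Π^tp_Y`; `IsTateOrigin`: clause (a) ∀N) — the second field of abc-iut-L2-t8's `Sec2Hyps` as a theorem.
[cite: MochizukiEtTh2009, §1 p.13] -/
theorem ker_toEll_inf_GtpY_le_GtpYN_of_origins (h16 : D.IsThm16Origin) (hT : D.IsTateOrigin) (N : ℕ+) :
    (D.thetaToEll.comp D.toTheta).ker ⊓ D.GtpY ≤ D.GtpYN N := by
  obtain ⟨y₁, -, -, -, hy₁, -, -, -, -, ha, -, -, -⟩ := hT.tate N
  exact ker_toEll_inf_GtpY_le_GtpYN_of_tate N hy₁ ha (h16.gtpYN_fromCusp N) h16.exists_cuspidal_le_GtpY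

/-- **`Sec2Hyps` ⟸ {«`K = K̈`», `IsThm16Origin`, `IsTateOrigin`}**: at a joint origin, §2's bundle of hypotheses on the §1 groups
reduces to print's standing assumption «`K = K̈`» (Def. 2.5 p. 39 / Def. 1.7 (I) p. 27) — the binder `hSβ` of the K3 end-knits
at the origin predicates. [cite: MochizukiEtTh2009, Def 2.5 p.39] -/
theorem sec2Hyps_of_Kdd_eq_of_origins (hK : D.Kdd = D.K) (h16 : D.IsThm16Origin) (hT : D.IsTateOrigin) : D.Sec2Hyps where
  Kdd_eq := hK
  ker_toEll_le_GtpYN N := ker_toEll_inf_GtpY_le_GtpYN_of_origins h16 hT N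

end ThetaSetting

end Literature.AnabelianGeometry.EtaleTheta

end
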